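import Summits.QuantumFields.YangMills.Theorems.PencilRigidityNPointIsotropyDoubledOrbitKernelDegOneSymbol
import Summits.QuantumFields.YangMills.Theorems.PencilRigidityNPointIsotropyDoubledOrbitKernelDegOneTransform

/-!
# Degree-one doubled orbit kernel, IV: the kernel — stub `doubledOrbitKernel_degOne_of_universal`

Line `complex-rotation-bandlimit` of crux `PencilRigidity.NPointIsotropy` (stmt-QuantumFields-11686): the registered stub
`doubledOrbitKernel_degOne_of_universal`, the DEGREE-ONE case of the shared analytic input `stub_doubledOrbitKernel` of the
checked skeleton `Cruxes/NPointIsotropy/Lines/complex_rotation_bandlimit.lean` (and of the sibling crux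
`MirrorModularBoosts.CurvatureBoostCovariance`).  Hypotheses: a one-species family `S₁` on `ℝ⁴` with E2 along `e₀` and
translations (`h : OSReconstructionNoE1 S₁.toLabelled`), the OPERATOR CONE in the first spatial direction (every joint
spectral measure of `(H, P⃗)` is carried by `{p₀ ≥ |p₁|}`) and a UNIVERSAL tempered two-point measure `μ₀` (`|f̃|²μ₀` is a
joint spectral measure of `Ψ_f` for every positive-time one-point `f`).  Conclusion: with the type `N/2` (`N` the
temperedness order of `μ₀`), every compactly supported time-ordered one-point `F` has `ε > 0` such that the small
rotations `R_η F` stay time-ordered and the kernel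

  `K(z, w) = ∫_{|p₁| ≤ p₀} conj(m_F(z̄, p)) · m_F(w, p) dμ₀(p)`   (`m_F` the boosted symbol of file II)

is jointly holomorphic on `{|Re| < ε}²` (file I's product-integral lemma; domination by the ATOMS proved here and
the weights of file I against `(1+‖p‖)^{-N}`), satisfies `|K(θ̄, θ)| ≤ C e^{N |Im θ|}`, and equals
`𝔖₂(Θ(R_{η'}F)* ⊗ R_η F) = ⟪Ψ_{R_{η'}F}, Ψ_{R_η F}⟫` at real points (real angles = transforms of rotated test
functions, off-cone vanishing by the operator cone, polarisation through `μ₀`, `inner_fieldVec_fieldVec`).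
No field operators are needed in degree one: everything is a function of the commuting pair `(H, P⃗)` read
through `μ₀`.
-/

noncomputable section

namespace Summit.QuantumFields.YangMills.Theorems.NPointIsotropy.ComplexRotationBandlimit

namespace DegOne

open MeasureTheory Complex Set Filter Topology Metric
open scoped ComplexConjugate SchwartzMap LineDeriv InnerProductSpace
open Literature.MathematicalPhysics.QuantumLattice Literature.MathematicalPhysics.QuantumFieldTheory
open Summit.QuantumFields.YangMills.Theorems.NPointIsotropy.Negative (E4)

variable {bexp : ℂ → E4 → E4 → ℂ} {bsym : ((Fin 1 → E4) → ℂ) → ℂ → E4 → ℂ}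
  {lf : 𝓢((Fin 1 → E4), ℂ) → E4 → ℂ}

/-- **Product bound from atoms**: two nonnegative quantities obeying the atoms with constants `L` have product
`≤ 4^N (L₂₀+L₂ₙ)(L₃₀+L₃ₙ)(1 + N/(δe^{-m}))^N (1 + ‖p‖)^{-N}` on the cone. [folklore] -/
theorem mul_le_of_atoms {N : ℕ} {δ m : ℝ} (hδ : 0 < δ) {L : Fin 4 → ℕ → ℝ} {p : E4} (hp : |p 1| ≤ p 0)
    {X Y : ℝ} (hX0 : 0 ≤ X) (hY0 : 0 ≤ Y)
    (hX : ∀ k : Fin 4, k = 2 ∨ k = 3 → ∀ n : ℕ, |p k| ^ n * X ≤ L k n * Real.exp (-(δ * Real.exp (-m) * p 0)))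
    (hY : ∀ k : Fin 4, k = 2 ∨ k = 3 → ∀ n : ℕ, |p k| ^ n * Y ≤ L k n * Real.exp (-(δ * Real.exp (-m) * p 0))) :
    X * Y ≤ 4 ^ N * (L 2 0 + L 2 N) * (L 3 0 + L 3 N) * (1 + N / (δ * Real.exp (-m))) ^ N *
      (1 + ‖p‖) ^ (-(N : ℝ)) := by
  have hs : 0 < δ * Real.exp (-m) := mul_pos hδ (Real.exp_pos _)
  have h0 := hX 2 (Or.inl rfl) 0
  have h0' := hY 3 (Or.inr rfl) 0
  rw [pow_zero, one_mul] at h0 h0'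
  exact mul_le_weight hs hp hX0 hY0 h0 (hX 2 (Or.inl rfl) N) h0' (hY 3 (Or.inr rfl) N)

/-- The height factor grows at most like `e^{N m}`: `(1 + N/(δe^{-m}))^N ≤ (1 + N/δ)^N e^{Nm}` (`m ≥ 0`). [folklore] -/
theorem height_factor_le (N : ℕ) {δ : ℝ} (hδ : 0 < δ) {m : ℝ} (hm : 0 ≤ m) :
    (1 + N / (δ * Real.exp (-m))) ^ N ≤ (1 + N / δ) ^ N * Real.exp (N * m) := by
  have h1 : 1 + N / (δ * Real.exp (-m)) ≤ (1 + N / δ) * Real.exp m := by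
    rw [Real.exp_neg, ← div_eq_mul_inv, div_div_eq_mul_div, add_mul, one_mul]
    have : 1 ≤ Real.exp m := Real.one_le_exp hm
    have : 0 ≤ (N : ℝ) / δ * Real.exp m := by positivity
    nlinarith [div_mul_eq_mul_div ((N : ℝ)) δ (Real.exp m)]
  calc (1 + N / (δ * Real.exp (-m))) ^ N ≤ ((1 + N / δ) * Real.exp m) ^ N :=
        pow_le_pow_left₀ (by positivity) h1 N
    _ = (1 + N / δ) ^ N * Real.exp (N * m) := by rw [mul_pow, ← Real.exp_nat_mul]

section Exponent

variable (hbexp : bexp = fun θ u p =>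
    -((Complex.cos θ * u 0 + Complex.sin θ * u 1) * p 0) +
      ((-Complex.sin θ * u 0 + Complex.cos θ * u 1) * p 1 + u 2 * p 2 + u 3 * p 3) * I)
include hbexp

/-- After a real rotation `R_η` of the argument the Laplace–Fourier exponent is `bexp η`. [folklore] -/
theorem exponent_planeRot (η : ℝ) (u p : E4) :
    -((((planeRot (0 : Fin 3) η u) 0 * p 0 : ℝ)) : ℂ) +
      ((∑ j : Fin 3, (planeRot (0 : Fin 3) η u) j.succ * p j.succ : ℝ) : ℂ) * Complex.I =
    bexp η u p := by
  subst hbexp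
  simp only [Fin.sum_univ_three, planeRot_apply]
  simp only [show ((1 : Fin 3).succ : Fin 4) = 2 from rfl, show ((2 : Fin 3).succ : Fin 4) = 3 from rfl,
    show ((0 : Fin 3).succ : Fin 4) = 1 from rfl, show ((1 : Fin 4) = 0) = False by decide,
    show ((2 : Fin 4) = 0) = False by decide, show ((3 : Fin 4) = 0) = False by decide,
    show ((2 : Fin 4) = 1) = False by decide, show ((3 : Fin 4) = 1) = False by decide,
    if_true, if_false]
  push_cast
  ring

section Symbol

variable (hbsym : bsym = fun G θ p => ∫ a : Fin 1 → E4, G a * cexp (bexp θ (a 0) p))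
include hbsym

section RealAngles

variable (hlf : lf = fun f p => ∫ x : Fin 1 → E4, f x * Complex.exp (-(((x 0) 0 * p 0 : ℝ) : ℂ) +
    ((∑ j : Fin 3, (x 0) j.succ * p j.succ : ℝ) : ℂ) * Complex.I))
include hlf

/-- **Real angles**: the transform of the rotated test function `R_η F` is the boosted symbol
`m_F(η, ·)` (change of variables by the measure-preserving rotation). [folklore] -/
theorem lf_linActMulti_planeRot (F : 𝓢((Fin 1 → E4), ℂ)) (η : ℝ) (p : E4) :
    lf (linActMulti (planeRot (0 : Fin 3) η) F) p = bsym F η p := by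
  subst hlf hbsym
  dsimp only
  set R := planeRot (0 : Fin 3) η with hR
  have hΦ : MeasurePreserving (fun a : Fin 1 → E4 => fun i => R (a i)) volume volume :=
    volume_preserving_pi fun _ : Fin 1 => R.measurePreserving
  set Φm : (Fin 1 → E4) ≃ᵐ (Fin 1 → E4) :=
    MeasurableEquiv.piCongrRight fun _ : Fin 1 => R.toHomeomorph.toMeasurableEquiv with hΦm
  have hΦc : (Φm : (Fin 1 → E4) → (Fin 1 → E4)) = fun a i => R (a i) := rfl
  have hΦ' : MeasurePreserving Φm volume volume := by rw [hΦc]; exact hΦ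
  have key := hΦ'.integral_comp' (g := fun x : Fin 1 → E4 =>
    (linActMulti R F) x * Complex.exp (-(((x 0) 0 * p 0 : ℝ) : ℂ) +
      ((∑ j : Fin 3, (x 0) j.succ * p j.succ : ℝ) : ℂ) * Complex.I))
  rw [← key]
  congr 1
  funext a
  rw [hΦc]
  simp only [linActMulti_apply, LinearIsometryEquiv.symm_apply_apply]
  rw [hR, exponent_planeRot hbexp]

end RealAngles

/-! ## Atoms -/

/-- **Atom for the symbol**: `|p_k|^n |m_F(θ,p)| ≤ ‖∂_k^n F‖₁ e^{-δ e^{-m} p₀}` on the cone, for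
`|Re θ| < ε₀`, `|Im θ| ≤ m`. [folklore] -/
theorem atom_bsym (F : 𝓢((Fin 1 → E4), ℂ)) (hFc : HasCompactSupport (F : (Fin 1 → E4) → ℂ))
    {ε₀ δ : ℝ} (hδ : 0 ≤ δ)
    (hmargin : ∀ a ∈ tsupport (F : (Fin 1 → E4) → ℂ), ∀ α : ℝ, |α| < ε₀ →
      δ ≤ Real.cos α * a 0 0 + Real.sin α * a 0 1)
    {θ : ℂ} (hθ : |θ.re| < ε₀) {m : ℝ} (hm : |θ.im| ≤ m) {p : E4} (hp : |p 1| ≤ p 0)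
    {k : Fin 4} (hk : k = 2 ∨ k = 3) {v : Fin 1 → E4} (hv : v = fun _ => EuclideanSpace.single k (1 : ℝ))
    (n : ℕ) :
    |p k| ^ n * ‖bsym F θ p‖ ≤
      (∫ a, ‖((∂_{v})^[n] F : 𝓢((Fin 1 → E4), ℂ)) a‖) * Real.exp (-(δ * Real.exp (-m) * p 0)) := by
  rw [pow_mul_norm_bsym hbexp hbsym F hFc θ p hk hv n]
  have hp0 : 0 ≤ p 0 := (abs_nonneg _).trans hp
  have hsub := tsupport_iterate_lineDeriv_subset F v n
  refine (norm_bsym_le hbexp hbsym _ hδ (fun a ha => hmargin a (hsub ha) θ.re hθ) hp).trans ?_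
  refine mul_le_mul_of_nonneg_left ?_ (integral_nonneg fun _ => norm_nonneg _)
  rw [Real.exp_le_exp, neg_le_neg_iff, mul_assoc]
  refine mul_le_mul_of_nonneg_left (mul_le_mul_of_nonneg_right ?_ hp0) hδ
  exact Real.exp_le_exp.2 (neg_le_neg hm)

/-- **Atom for the derivative of the symbol** (Cauchy bound on the circle of radius `ε₀/2`):
`|p_k|^n |∂_θ m_F(θ,p)| ≤ (‖∂_k^n F‖₁/(ε₀/2)) e^{-δ e^{-m} p₀}` on the cone, for `|Re θ| < ε₀/2`,
`|Im θ| + ε₀/2 ≤ m`. [folklore] -/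
theorem atom_deriv_bsym (F : 𝓢((Fin 1 → E4), ℂ)) (hFc : HasCompactSupport (F : (Fin 1 → E4) → ℂ))
    {ε₀ δ : ℝ} (hε₀ : 0 < ε₀) (hδ : 0 ≤ δ)
    (hmargin : ∀ a ∈ tsupport (F : (Fin 1 → E4) → ℂ), ∀ α : ℝ, |α| < ε₀ →
      δ ≤ Real.cos α * a 0 0 + Real.sin α * a 0 1)
    {θ : ℂ} (hθ : |θ.re| < ε₀ / 2) {m : ℝ} (hm : |θ.im| + ε₀ / 2 ≤ m) {p : E4} (hp : |p 1| ≤ p 0)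
    {k : Fin 4} (hk : k = 2 ∨ k = 3) {v : Fin 1 → E4} (hv : v = fun _ => EuclideanSpace.single k (1 : ℝ))
    (n : ℕ) :
    |p k| ^ n * ‖deriv (fun θ => bsym F θ p) θ‖ ≤
      (∫ a, ‖((∂_{v})^[n] F : 𝓢((Fin 1 → E4), ℂ)) a‖) / (ε₀ / 2) *
        Real.exp (-(δ * Real.exp (-m) * p 0)) := by
  rw [pow_mul_norm_deriv_bsym hbexp hbsym F hFc θ p hk hv n, div_mul_eq_mul_div]
  have hp0 : 0 ≤ p 0 := (abs_nonneg _).trans hp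
  have hsub := tsupport_iterate_lineDeriv_subset F v n
  refine norm_deriv_bsym_le_of_sphere hbexp hbsym _ (hasCompactSupport_iterate_lineDeriv F hFc _ n) p
    (half_pos hε₀) fun ζ hζ => ?_
  obtain ⟨hre, him⟩ := abs_re_im_le_of_mem_sphere hζ
  have hζre : |ζ.re| < ε₀ := by linarith
  refine (norm_bsym_le hbexp hbsym _ hδ (fun a ha => hmargin a (hsub ha) ζ.re hζre) hp).trans ?_
  refine mul_le_mul_of_nonneg_left ?_ (integral_nonneg fun _ => norm_nonneg _)
  rw [Real.exp_le_exp, neg_le_neg_iff, mul_assoc]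
  refine mul_le_mul_of_nonneg_left (mul_le_mul_of_nonneg_right ?_ hp0) hδ
  exact Real.exp_le_exp.2 (neg_le_neg (him.trans hm))

/-- **The atoms, packaged**: nonnegative constants `L k n` with
`|p_k|^n |m_F(θ,p)|, |p_k|^n |∂_θ m_F(θ,p)| ≤ L k n · e^{-δ e^{-m} p₀}` on the cone, for `|Re θ| < ε₀/2`,
`|Im θ| + ε₀/2 ≤ m`, `k = 2, 3`. [folklore] -/
theorem atoms_pack (F : 𝓢((Fin 1 → E4), ℂ)) (hFc : HasCompactSupport (F : (Fin 1 → E4) → ℂ))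
    {ε₀ δ : ℝ} (hε₀ : 0 < ε₀) (hδ : 0 ≤ δ)
    (hmargin : ∀ a ∈ tsupport (F : (Fin 1 → E4) → ℂ), ∀ α : ℝ, |α| < ε₀ →
      δ ≤ Real.cos α * a 0 0 + Real.sin α * a 0 1) :
    ∃ L : Fin 4 → ℕ → ℝ, (∀ k n, 0 ≤ L k n) ∧
      ∀ θ : ℂ, |θ.re| < ε₀ / 2 → ∀ m : ℝ, |θ.im| + ε₀ / 2 ≤ m → ∀ p : E4, |p 1| ≤ p 0 →
        ∀ k : Fin 4, k = 2 ∨ k = 3 → ∀ n : ℕ,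
          |p k| ^ n * ‖bsym F θ p‖ ≤ L k n * Real.exp (-(δ * Real.exp (-m) * p 0)) ∧
          |p k| ^ n * ‖deriv (fun θ => bsym F θ p) θ‖ ≤ L k n * Real.exp (-(δ * Real.exp (-m) * p 0)) := by
  refine ⟨fun k n =>
    (∫ a, ‖((∂_{fun _ : Fin 1 => EuclideanSpace.single k (1 : ℝ)})^[n] F : 𝓢((Fin 1 → E4), ℂ)) a‖) +
    (∫ a, ‖((∂_{fun _ : Fin 1 => EuclideanSpace.single k (1 : ℝ)})^[n] F : 𝓢((Fin 1 → E4), ℂ)) a‖) / (ε₀ / 2),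
    fun k n => ?_, fun θ hθ m hm p hp k hk n => ⟨?_, ?_⟩⟩
  · have h0 : 0 ≤ ∫ a, ‖((∂_{fun _ : Fin 1 => EuclideanSpace.single k (1 : ℝ)})^[n] F :
        𝓢((Fin 1 → E4), ℂ)) a‖ := integral_nonneg fun _ => norm_nonneg _
    have := div_nonneg h0 (half_pos hε₀).le
    exact add_nonneg h0 this
  · have h1 := atom_bsym hbexp hbsym F hFc hδ hmargin (θ := θ) (m := m) (by linarith)
      (by linarith [abs_nonneg θ.im]) hp hk rfl n
    refine h1.trans (mul_le_mul_of_nonneg_right ?_ (Real.exp_pos _).le)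
    exact le_add_of_nonneg_right (div_nonneg (integral_nonneg fun _ => norm_nonneg _) (half_pos hε₀).le)
  · have h1 := atom_deriv_bsym hbexp hbsym F hFc hε₀ hδ hmargin hθ hm hp hk rfl n
    refine h1.trans (mul_le_mul_of_nonneg_right ?_ (Real.exp_pos _).le)
    exact le_add_of_nonneg_left (integral_nonneg fun _ => norm_nonneg _)



variable (μ₀ : Measure E4)

/-- **Joint holomorphy of the kernel on the strip square** `{|Re| < ε₀/2}²`. [folklore] -/
theorem differentiableOn_kernel (F : 𝓢((Fin 1 → E4), ℂ)) (hFc : HasCompactSupport (F : (Fin 1 → E4) → ℂ))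
    {ε₀ δ : ℝ} (hε₀ : 0 < ε₀) (hδ : 0 < δ)
    (hmargin : ∀ a ∈ tsupport (F : (Fin 1 → E4) → ℂ), ∀ α : ℝ, |α| < ε₀ →
      δ ≤ Real.cos α * a 0 0 + Real.sin α * a 0 1)
    {N : ℕ} (hint : Integrable (fun p : E4 => (1 + ‖p‖) ^ (-(N : ℝ))) μ₀) :
    DifferentiableOn ℂ (Function.uncurry fun z w : ℂ =>
        ∫ p in {p : E4 | |p 1| ≤ p 0}, conj (bsym F (conj z) p) * bsym F w p ∂μ₀)
      ({z : ℂ | |z.re| < ε₀ / 2} ×ˢ {z : ℂ | |z.re| < ε₀ / 2}) := by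
  obtain ⟨L, hL0, hL⟩ := atoms_pack hbexp hbsym F hFc hε₀ hδ.le hmargin
  have hC : MeasurableSet {p : E4 | |p 1| ≤ p 0} := measurableSet_le (by fun_prop) (by fun_prop)
  intro zw hzw
  obtain ⟨hz, hw⟩ := mem_prod.1 hzw
  simp only [Set.mem_setOf_eq] at hz hw
  set m : ℝ := max |zw.1.im| |zw.2.im| + ε₀ / 2 + 1 with hm
  set U : Set ℂ := {z : ℂ | |z.re| < ε₀ / 2} ∩ {z : ℂ | |z.im| + ε₀ / 2 < m} with hU
  have hUo : IsOpen U :=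
    (isOpen_lt (by fun_prop) continuous_const).inter (isOpen_lt (by fun_prop) continuous_const)
  have hzU : zw.1 ∈ U := ⟨hz, by
    show |zw.1.im| + ε₀ / 2 < m
    have := le_max_left |zw.1.im| |zw.2.im|; linarith⟩
  have hwU : zw.2 ∈ U := ⟨hw, by
    show |zw.2.im| + ε₀ / 2 < m
    have := le_max_right |zw.1.im| |zw.2.im|; linarith⟩
  have hconjU : ∀ z ∈ U, conj z ∈ U := fun z hz' => by
    obtain ⟨h1, h2⟩ := hz'
    simp only [hU, Set.mem_inter_iff, Set.mem_setOf_eq, Complex.conj_re, Complex.conj_im, abs_neg] at h1 h2 ⊢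
    exact ⟨h1, h2⟩
  -- the atoms on `U`, for the symbol and its derivative, plain and conjugated
  have aB : ∀ w ∈ U, ∀ p : E4, |p 1| ≤ p 0 → ∀ k : Fin 4, k = 2 ∨ k = 3 → ∀ n : ℕ,
      |p k| ^ n * ‖bsym F w p‖ ≤ L k n * Real.exp (-(δ * Real.exp (-m) * p 0)) :=
    fun w hw' p hp k hk n => (hL w hw'.1 m (le_of_lt hw'.2) p hp k hk n).1
  have aB' : ∀ w ∈ U, ∀ p : E4, |p 1| ≤ p 0 → ∀ k : Fin 4, k = 2 ∨ k = 3 → ∀ n : ℕ,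
      |p k| ^ n * ‖deriv (fun θ => bsym F θ p) w‖ ≤ L k n * Real.exp (-(δ * Real.exp (-m) * p 0)) :=
    fun w hw' p hp k hk n => (hL w hw'.1 m (le_of_lt hw'.2) p hp k hk n).2
  have aA : ∀ z ∈ U, ∀ p : E4, |p 1| ≤ p 0 → ∀ k : Fin 4, k = 2 ∨ k = 3 → ∀ n : ℕ,
      |p k| ^ n * ‖conj (bsym F (conj z) p)‖ ≤ L k n * Real.exp (-(δ * Real.exp (-m) * p 0)) :=
    fun z hz' p hp k hk n => by rw [Complex.norm_conj]; exact aB _ (hconjU z hz') p hp k hk n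
  have aA' : ∀ z ∈ U, ∀ p : E4, |p 1| ≤ p 0 → ∀ k : Fin 4, k = 2 ∨ k = 3 → ∀ n : ℕ,
      |p k| ^ n * ‖conj (deriv (fun θ => bsym F θ p) (conj z))‖ ≤
        L k n * Real.exp (-(δ * Real.exp (-m) * p 0)) :=
    fun z hz' p hp k hk n => by rw [Complex.norm_conj]; exact aB' _ (hconjU z hz') p hp k hk n
  set μc := μ₀.restrict {p : E4 | |p 1| ≤ p 0}
  have hD := differentiableOn_integral_mul μc hUo hUo
    (fun z p => conj (bsym F (conj z) p)) (fun z p => conj (deriv (fun θ => bsym F θ p) (conj z)))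
    (fun w p => bsym F w p) (fun w p => deriv (fun θ => bsym F θ p) w)
    (fun p => 4 ^ N * (L 2 0 + L 2 N) * (L 3 0 + L 3 N) * (1 + N / (δ * Real.exp (-m))) ^ N *
      (1 + ‖p‖) ^ (-(N : ℝ)))
    ((hint.mono_measure Measure.restrict_le_self).const_mul _)
    (fun z _ p => by
      have h1 := ((differentiable_bsym hbexp hbsym F hFc p) (conj z)).hasDerivAt.conj_conj
      rw [Complex.conj_conj] at h1
      exact h1)
    (fun w _ p => ((differentiable_bsym hbexp hbsym F hFc p) w).hasDerivAt)
    (fun z => (Complex.continuous_conj.comp_stronglyMeasurable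
      (stronglyMeasurable_bsym hbexp hbsym F (conj z))).aestronglyMeasurable)
    (fun z => (Complex.continuous_conj.comp_stronglyMeasurable
      (stronglyMeasurable_deriv_bsym hbexp hbsym F hFc (conj z))).aestronglyMeasurable)
    (fun w => (stronglyMeasurable_bsym hbexp hbsym F w).aestronglyMeasurable)
    (fun w => (stronglyMeasurable_deriv_bsym hbexp hbsym F hFc w).aestronglyMeasurable)
    ((ae_restrict_mem hC).mono fun p hp z hz' w hw' =>
      mul_le_of_atoms hδ hp (norm_nonneg _) (norm_nonneg _) (aA z hz' p hp) (aB w hw' p hp))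
    ((ae_restrict_mem hC).mono fun p hp z hz' w hw' =>
      mul_le_of_atoms hδ hp (norm_nonneg _) (norm_nonneg _) (aA' z hz' p hp) (aB w hw' p hp))
    ((ae_restrict_mem hC).mono fun p hp z hz' w hw' =>
      mul_le_of_atoms hδ hp (norm_nonneg _) (norm_nonneg _) (aA z hz' p hp) (aB' w hw' p hp))
  exact (hD.differentiableAt ((hUo.prod hUo).mem_nhds ⟨hzU, hwU⟩)).differentiableWithinAt

/-- **Exponential type `N` of the conjugate diagonal** `θ ↦ K(θ̄, θ) = ∫_{cone} |m_F(θ,p)|² dμ₀`. [folklore] -/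
theorem norm_kernel_conj_le (F : 𝓢((Fin 1 → E4), ℂ)) (hFc : HasCompactSupport (F : (Fin 1 → E4) → ℂ))
    {ε₀ δ : ℝ} (hε₀ : 0 < ε₀) (hδ : 0 < δ)
    (hmargin : ∀ a ∈ tsupport (F : (Fin 1 → E4) → ℂ), ∀ α : ℝ, |α| < ε₀ →
      δ ≤ Real.cos α * a 0 0 + Real.sin α * a 0 1)
    {N : ℕ} (hint : Integrable (fun p : E4 => (1 + ‖p‖) ^ (-(N : ℝ))) μ₀) :
    ∃ C : ℝ, ∀ θ : ℂ, |θ.re| < ε₀ / 2 →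
      ‖(fun z w : ℂ => ∫ p in {p : E4 | |p 1| ≤ p 0}, conj (bsym F (conj z) p) * bsym F w p ∂μ₀)
        (starRingEnd ℂ θ) θ‖ ≤ C * Real.exp (2 * (N / 2 : ℝ) * |θ.im|) := by
  obtain ⟨L, hL0, hL⟩ := atoms_pack hbexp hbsym F hFc hε₀ hδ.le hmargin
  have hC : MeasurableSet {p : E4 | |p 1| ≤ p 0} := measurableSet_le (by fun_prop) (by fun_prop)
  refine ⟨4 ^ N * (L 2 0 + L 2 N) * (L 3 0 + L 3 N) * (1 + N / δ) ^ N * Real.exp (N * (ε₀ / 2)) *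
    ∫ p in {p : E4 | |p 1| ≤ p 0}, (1 + ‖p‖) ^ (-(N : ℝ)) ∂μ₀, fun θ hθ => ?_⟩
  set m := |θ.im| + ε₀ / 2 with hm
  have hm0 : 0 ≤ m := by positivity
  dsimp only
  rw [Complex.conj_conj]
  have hbd : ∀ᵐ p ∂(μ₀.restrict {p : E4 | |p 1| ≤ p 0}), ‖conj (bsym F θ p) * bsym F θ p‖ ≤
      4 ^ N * (L 2 0 + L 2 N) * (L 3 0 + L 3 N) * (1 + N / (δ * Real.exp (-m))) ^ N *
        (1 + ‖p‖) ^ (-(N : ℝ)) :=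
    (ae_restrict_mem hC).mono fun p hp => by
      rw [norm_mul, Complex.norm_conj]
      exact mul_le_of_atoms hδ hp (norm_nonneg _) (norm_nonneg _)
        (fun k hk n => (hL θ hθ m le_rfl p hp k hk n).1) (fun k hk n => (hL θ hθ m le_rfl p hp k hk n).1)
  refine (norm_integral_le_of_norm_le ((hint.mono_measure Measure.restrict_le_self).const_mul _)
    hbd).trans ?_
  rw [integral_const_mul]
  have hI : 0 ≤ ∫ p in {p : E4 | |p 1| ≤ p 0}, (1 + ‖p‖) ^ (-(N : ℝ)) ∂μ₀ :=
    integral_nonneg fun p => by positivity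
  have hP : 0 ≤ 4 ^ N * (L 2 0 + L 2 N) * (L 3 0 + L 3 N) := by
    have := hL0 2 0; have := hL0 2 N; have := hL0 3 0; have := hL0 3 N
    positivity
  have hexp : Real.exp (N * m) = Real.exp (N * (ε₀ / 2)) * Real.exp (2 * (N / 2 : ℝ) * |θ.im|) := by
    rw [← Real.exp_add]; congr 1; ring
  calc 4 ^ N * (L 2 0 + L 2 N) * (L 3 0 + L 3 N) * (1 + N / (δ * Real.exp (-m))) ^ N *
        ∫ p in {p : E4 | |p 1| ≤ p 0}, (1 + ‖p‖) ^ (-(N : ℝ)) ∂μ₀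
      ≤ 4 ^ N * (L 2 0 + L 2 N) * (L 3 0 + L 3 N) * ((1 + N / δ) ^ N * Real.exp (N * m)) *
          ∫ p in {p : E4 | |p 1| ≤ p 0}, (1 + ‖p‖) ^ (-(N : ℝ)) ∂μ₀ :=
        mul_le_mul_of_nonneg_right (mul_le_mul_of_nonneg_left (height_factor_le N hδ hm0) hP) hI
    _ = _ := by rw [hexp]; ring

section RealPoints

variable {S₁ : SchwingerFamily E4} (h : OSReconstructionNoE1 S₁.toLabelled)
  (hlf : lf = fun f p => ∫ x : Fin 1 → E4, f x * Complex.exp (-(((x 0) 0 * p 0 : ℝ) : ℂ) +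
    ((∑ j : Fin 3, (x 0) j.succ * p j.succ : ℝ) : ℂ) * Complex.I))
include hlf

/-- **Real angles**: `K(η', η) = 𝔖₂(Θ(R_{η'}F)* ⊗ R_η F)` for any tensor witness — the off-cone part of
`μ₀` does not see time-ordered transforms (operator cone), polarisation through `μ₀`, and
`⟪Ψ_{f'}, Ψ_f⟫ = 𝔖₂(Θf'* ⊗ f)`. [folklore] -/
theorem kernel_ofReal
    (hcone : ∀ (ψ : h.Hilbert) (μ : Measure E4), h.IsJointSpectralMeasure ψ μ →
      μ {p : E4 | p 0 < |p 1|} = 0)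
    (hμ : ∀ (f : 𝓢((Fin 1 → E4), ℂ)) (hf : IsTimeOrdered f),
      h.IsJointSpectralMeasure (h.fieldVec 1 (fun _ => ()) f hf)
        (μ₀.withDensity fun p => ENNReal.ofReal (‖lf f p‖ ^ 2)))
    (F : 𝓢((Fin 1 → E4), ℂ)) (hFc : HasCompactSupport (F : (Fin 1 → E4) → ℂ))
    {ε₀ δ : ℝ} (hδ : 0 < δ)
    (hmargin : ∀ a ∈ tsupport (F : (Fin 1 → E4) → ℂ), ∀ α : ℝ, |α| < ε₀ →
      δ ≤ Real.cos α * a 0 0 + Real.sin α * a 0 1)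
    {η η' : ℝ} (hη : |η| < ε₀) (hη' : |η'| < ε₀) (H : 𝓢((Fin (1 + 1) → E4), ℂ))
    (hH : IsAppendTensorOf H (osAdjoint (linActMulti (planeRot (0 : Fin 3) η') F))
      (linActMulti (planeRot (0 : Fin 3) η) F)) :
    (fun z w : ℂ => ∫ p in {p : E4 | |p 1| ≤ p 0}, conj (bsym F (conj z) p) * bsym F w p ∂μ₀) η' η =
      S₁ (1 + 1) H := by
  have hf := isTimeOrdered_linActMulti_planeRot F hδ hmargin hη
  have hf' := isTimeOrdered_linActMulti_planeRot F hδ hmargin hη'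
  have hfc := hasCompactSupport_linActMulti (planeRot (0 : Fin 3) η) hFc
  have hf'c := hasCompactSupport_linActMulti (planeRot (0 : Fin 3) η') hFc
  dsimp only
  rw [Complex.conj_ofReal]
  simp_rw [← lf_linActMulti_planeRot hbexp hbsym hlf F η, ← lf_linActMulti_planeRot hbexp hbsym hlf F η']
  rw [setIntegral_eq_integral_of_ae_compl_eq_zero,
    ← inner_fieldVec_eq_integral_lf hlf h μ₀ hμ hf' hf hf'c hfc, h.inner_fieldVec_fieldVec _ _ hf' hf hH]
  · rfl
  · have hz := lf_ae_eq_zero_off_cone hlf μ₀ (hcone _ _ (hμ _ hf))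
    filter_upwards [hz] with p hp hpc
    rw [hp (by simpa [not_le] using hpc), mul_zero]

end RealPoints

end Symbol

end Exponent

end DegOne

/-- **Real angles: the Laplace–Fourier transform of a rotated one-point test function is the boosted symbol**
(registered form of `DegOne.lf_linActMulti_planeRot`, with transform and symbol written out). [folklore] -/
theorem transform_linActMulti_planeRot : ∀ (F : SchwartzMap (Fin 1 → EuclideanSpace ℝ (Fin 4)) ℂ) (η : ℝ) (p : EuclideanSpace ℝ (Fin 4)), (∫ x : Fin 1 → EuclideanSpace ℝ (Fin 4), (Literature.MathematicalPhysics.QuantumLattice.linActMulti (Literature.MathematicalPhysics.QuantumFieldTheory.planeRot (0 : Fin 3) η) F) x * Complex.exp (-(((x 0) 0 * p 0 : ℝ) : ℂ) + ((∑ j : Fin 3, (x 0) j.succ * p j.succ : ℝ) : ℂ) * Complex.I)) = ∫ a : Fin 1 → EuclideanSpace ℝ (Fin 4), F a * Complex.exp (-((Complex.cos η * (a 0) 0 + Complex.sin η * (a 0) 1) * p 0) + ((-Complex.sin η * (a 0) 0 + Complex.cos η * (a 0) 1) * p 1 + (a 0) 2 * p 2 + (a 0) 3 * p 3) * Complex.I)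 :=
  fun F η p => DegOne.lf_linActMulti_planeRot rfl rfl rfl F η p

open MeasureTheory in
open scoped ComplexConjugate in
open DegOne in
/-- **The doubled orbit kernel in degree one, from a universal two-point measure.**  For a one-species family on
`ℝ⁴` with E2 along `e₀` and translations (`h : OSReconstructionNoE1 S₁.toLabelled`), the operator cone in the first
spatial direction and a tempered measure `μ₀` on `{p₀ ≥ 0}` through which `|f̃|²μ₀` is a joint spectral measure of every
positive-time one-point field vector `Ψ_f`, there is a type `N/2` such that every compactly supported time-ordered
one-point `F` admits `ε > 0` with: small rotations `R_η F` stay time-ordered, and the kernel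
`K(z, w) = ∫_{|p₁| ≤ p₀} conj(m_F(z̄,p)) m_F(w,p) dμ₀(p)` of the boosted symbols is jointly holomorphic on the strip
square `{|Re| < ε}²`, has `|K(θ̄,θ)| ≤ C e^{N|Im θ|}`, and equals `𝔖₂(Θ(R_{η'}F)* ⊗ R_η F)` at real points. [folklore] -/
theorem doubledOrbitKernel_degOne_of_universal : ∀ (S₁ : Literature.MathematicalPhysics.QuantumLattice.SchwingerFamily (EuclideanSpace ℝ (Fin 4))) (h : Literature.MathematicalPhysics.QuantumFieldTheory.OSReconstructionNoE1 S₁.toLabelled), S₁.toLabelled.HasLinearGrowth → (∀ (ψ : h.Hilbert) (μ : MeasureTheory.Measure (EuclideanSpace ℝ (Fin 4))), h.IsJointSpectralMeasure ψ μ → μ {p : EuclideanSpace ℝ (Fin 4) | p 0 < |p 1|} = 0) → ∀ (μ₀ : MeasureTheory.Measure (EuclideanSpace ℝ (Fin 4))) (N : ℕ), MeasureTheory.Integrable (fun p : EuclideanSpace ℝ (Fin 4) => (1 + ‖p‖) ^ (-(N : ℝ))) μ₀ → μ₀ {p : EuclideanSpace ℝ (Fin 4) | p 0 < 0} = 0 →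 (∀ (f : SchwartzMap (Fin 1 → EuclideanSpace ℝ (Fin 4)) ℂ) (hf : Literature.MathematicalPhysics.QuantumLattice.IsTimeOrdered f), h.IsJointSpectralMeasure (h.fieldVec 1 (fun _ => ()) f hf) (μ₀.withDensity fun p : EuclideanSpace ℝ (Fin 4) => ENNReal.ofReal (‖∫ x : Fin 1 → EuclideanSpace ℝ (Fin 4), f x * Complex.exp (-(((x 0) 0 * p 0 : ℝ) : ℂ) + ((∑ j : Fin 3, (x 0) j.succ * p j.succ : ℝ) : ℂ) * Complex.I)‖ ^ 2))) → ∃ Nty : ℝ, ∀ (F : SchwartzMap (Fin 1 → EuclideanSpace ℝ (Fin 4)) ℂ), Literature.MathematicalPhysics.QuantumLattice.IsTimeOrdered F → HasCompactSupport (F : (Fin 1 → EuclideanSpace ℝ (Fin 4)) → ℂ) → ∃ ε : ℝ, 0 < ε ∧ (∀ η : ℝ, |η| < ε → Literature.MathematicalPhysics.QuantumLattice.IsTimeOrdered (Literature.MathematicalPhysics.QuantumLattice.linActMulti (Literature.MathematicalPhysics.QuantumFieldTheory.planeRot (0 : Fin 3) η) F)) ∧ ∃ (K : ℂ → ℂ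 → ℂ) (C : ℝ), DifferentiableOn ℂ (Function.uncurry K) ({z : ℂ | |z.re| < ε} ×ˢ {z : ℂ | |z.re| < ε}) ∧ (∀ θ : ℂ, |θ.re| < ε → ‖K (starRingEnd ℂ θ) θ‖ ≤ C * Real.exp (2 * Nty * |θ.im|)) ∧ ∀ η η' : ℝ, |η| < ε → |η'| < ε → ∀ H : SchwartzMap (Fin (1 + 1) → EuclideanSpace ℝ (Fin 4)) ℂ, Literature.MathematicalPhysics.QuantumLattice.IsAppendTensorOf H (Literature.MathematicalPhysics.QuantumLattice.osAdjoint (Literature.MathematicalPhysics.QuantumLattice.linActMulti (Literature.MathematicalPhysics.QuantumFieldTheory.planeRot (0 : Fin 3) η') F)) (Literature.MathematicalPhysics.QuantumLattice.linActMulti (Literature.MathematicalPhysics.QuantumFieldTheory.planeRot (0 : Fin 3) η) F) → K η' η = S₁ (1 + 1) H := by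
  intro S₁ h _ hcone μ₀ N hint _ hμ
  refine ⟨(N : ℝ) / 2, fun F hF hFc => ?_⟩
  obtain ⟨ε₀, δ, hε₀, hδ, hmargin⟩ := exists_margin F hF hFc
  obtain ⟨C, hC⟩ := norm_kernel_conj_le (bexp := fun θ u p =>
      -((Complex.cos θ * u 0 + Complex.sin θ * u 1) * p 0) +
        ((-Complex.sin θ * u 0 + Complex.cos θ * u 1) * p 1 + u 2 * p 2 + u 3 * p 3) * Complex.I)
    rfl rfl μ₀ F hFc hε₀ hδ hmargin hint
  refine ⟨ε₀ / 2, half_pos hε₀, fun η hη =>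
    isTimeOrdered_linActMulti_planeRot F hδ hmargin (lt_of_lt_of_le hη (by linarith)), _, C,
    differentiableOn_kernel rfl rfl μ₀ F hFc hε₀ hδ hmargin hint, hC,
    fun η η' hη hη' H hH => kernel_ofReal rfl rfl μ₀ h rfl hcone hμ F hFc hδ hmargin
      (lt_of_lt_of_le hη (by linarith)) (lt_of_lt_of_le hη' (by linarith)) H hH⟩

end Summit.QuantumFields.YangMills.Theorems.NPointIsotropy.ComplexRotationBandlimit

end
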